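import Summits.RiemannHypothesis.RiemannHypothesis.Theorems.OddSectorOddOneSignedWindowsFormDomainTools
import Summits.RiemannHypothesis.RiemannHypothesis.Theorems.WeilParityEvenWinsArchDilationEnergy
import HarnessLib

/-!
# Form-domain tools in the odd sector, II: the energy of dilates of a finite-energy window function
# (helper for crux `OddSector.OddOneSignedWindows`, item stmt-RiemannHypothesis-17778; RH-free)

Support lemmas for `Theorems/OddSectorOddOneSignedWindowsFormDomainGroundState.lean`. For
`f ∈ L²` living on `[-b, b]` with finite archimedean energy, the energies of the unitary dilates
`f_η = weilDilate η f` (`f_η(x) = (1+η)^{1/2} f((1+η)x)`, Bombieri's variation) converge as `η → 0⁺`: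
`𝓔_a(f_{ηₙ}) → 𝓔_a(f)` (`tendsto_weilDirichletEnergy_weilDilate`, registered form
`weilDirichletEnergy_weilDilate_tendsto`). Ingredients: `D_t(f_η) = D_{(1+η)t}(f)`
(`weilIncrement_weilDilate`, tree); continuity of `t ↦ D_t(f)` (part I,
`continuous_weilIncrement_of_memLp`) for the prime lengths; and for the archimedean part the
substitution `s = (1+η)t` (`archEnergy_weilDilate_eq`) followed by dominated convergence
(`tendsto_archEnergy_weilDilate`) with dominator built from `ρ(s/2) ≤ 2e^{s/4}ρ(s)`
(`weilArchDensity_half_le`), `ρ(s) ≤ e^{-s/2}/(1 − e^{-4b})` beyond `2b`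
(`weilArchDensity_le_exp_neg`) and `D_s(f) = 2‖f‖₂²` beyond `2b`
(`WeilParity.EvenWinsArch.dilationEnergy_weilIncrement_eq_two_mul`, tree).

References: E. Bombieri, Rend. Mat. Acc. Lincei (9) 11 (2000), §4 Thm 5 (the dilation);
M. Suzuki, arXiv:2606.09096, §4.2 (dilation covariance of the jump form).
-/


noncomputable section

set_option linter.dupNamespace false

open MeasureTheory Set Filter
open scoped Topology ENNReal ArithmeticFunction.vonMangoldt

namespace Summit.RiemannHypothesis.RiemannHypothesis.Theorems.OddSector

open Literature.NumberTheory.LFunctions Literature.NumberTheory.LFunctions.ConnesVanSuijlekom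
open Summit.RiemannHypothesis.RiemannHypothesis.Theorems.WeilGroundStateMarkovPart

/-! ### The archimedean density: two elementary bounds -/

/-- `ρ(s/2) ≤ 2 e^{s/4} ρ(s)` for `s > 0` (`sinh s = 2 sinh(s/2) cosh(s/2)` and `cosh(s/2) ≤ e^{s/2}`).
[folklore] -/
theorem weilArchDensity_half_le {s : ℝ} (hs : 0 < s) :
    weilArchDensity (s / 2) ≤ 2 * Real.exp (s / 4) * weilArchDensity s := by
  unfold weilArchDensity
  have hS : 0 < Real.sinh (s / 2) := Real.sinh_pos_iff.2 (by positivity)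
  have hA : 0 < Real.exp (s / 2 / 2) := Real.exp_pos _
  have hC : 0 < Real.cosh (s / 2) := Real.cosh_pos _
  have hCE : Real.cosh (s / 2) ≤ Real.exp (s / 2) := by
    rw [Real.cosh_eq]
    have : Real.exp (-(s / 2)) ≤ Real.exp (s / 2) := Real.exp_le_exp.2 (by linarith)
    linarith
  have hsinh : Real.sinh s = 2 * Real.sinh (s / 2) * Real.cosh (s / 2) := by
    rw [← Real.sinh_two_mul]; ring_nf
  have e4 : Real.exp (s / 4) = Real.exp (s / 2 / 2) := by ring_nf
  rw [hsinh, e4, div_le_iff₀ (by positivity)]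
  have hE : 0 < Real.exp (s / 2) := Real.exp_pos _
  rw [show 2 * Real.exp (s / 2 / 2) * (Real.exp (s / 2) / (2 * (2 * Real.sinh (s / 2) * Real.cosh (s / 2)))) *
      (2 * Real.sinh (s / 2)) = Real.exp (s / 2 / 2) * (Real.exp (s / 2) / Real.cosh (s / 2)) by
    field_simp]
  rw [le_mul_iff_one_le_right hA, one_le_div hC]
  exact hCE

/-- `ρ(s) ≤ e^{-s/2}/(1 − e^{-4b})` for `s ≥ 2b > 0` (`ρ(s) = (e^{s/2} − e^{-3s/2})⁻¹`). [folklore] -/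
theorem weilArchDensity_le_exp_neg {b s : ℝ} (hb : 0 < b) (hs : 2 * b ≤ s) :
    weilArchDensity s ≤ Real.exp (-(s / 2)) / (1 - Real.exp (-(4 * b))) := by
  have hs0 : 0 < s := by linarith
  have hq : 0 < 1 - Real.exp (-(4 * b)) := by
    rw [sub_pos, Real.exp_lt_one_iff]; linarith
  rw [le_div_iff₀ hq, weilArchDensity_eq_inv hs0]
  have hden : 0 < Real.exp (s / 2) - Real.exp (-(3 * s / 2)) :=
    sub_pos.2 (Real.exp_lt_exp.2 (by linarith))
  rw [inv_mul_le_iff₀ hden]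
  have e0 : s / 2 + -(s / 2) = 0 := by ring
  have e2 : -(3 * s / 2) + -(s / 2) = -(2 * s) := by ring
  have e1 : (Real.exp (s / 2) - Real.exp (-(3 * s / 2))) * Real.exp (-(s / 2)) =
      1 - Real.exp (-(2 * s)) := by
    rw [sub_mul, ← Real.exp_add, ← Real.exp_add, e0, e2, Real.exp_zero]
  rw [e1]
  linarith [Real.exp_le_exp.2 (show -(2 * s) ≤ -(4 * b) by linarith)]

/-- `ρ` is continuous at every `s > 0`. [folklore] -/
theorem continuousAt_weilArchDensity {s : ℝ} (hs : 0 < s) : ContinuousAt weilArchDensity s := by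
  unfold weilArchDensity
  refine ContinuousAt.div (by fun_prop) (by fun_prop) ?_
  exact mul_ne_zero two_ne_zero (Real.sinh_pos_iff.2 hs).ne'

/-! ### The energy of dilates -/

/-- **The archimedean energy of a dilate, by substitution**: for `η > -1`,
`∫₀^∞ ρ(t) D_t(f_η) dt = (1+η)⁻¹ ∫₀^∞ ρ(s/(1+η)) D_s(f) ds` (`D_t(f_η) = D_{(1+η)t}(f)`,
`s = (1+η)t`). [folklore] -/
theorem archEnergy_weilDilate_eq (f : ℝ → ℂ) {η : ℝ} (hη : -1 < η) :
    ∫ t in Ioi (0 : ℝ), weilArchDensity t * weilIncrement (weilDilate η f) t =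
      (1 + η)⁻¹ * ∫ s in Ioi (0 : ℝ), weilArchDensity (s / (1 + η)) * weilIncrement f s := by
  have hc : 0 < 1 + η := by linarith
  have h := integral_comp_mul_left_Ioi
    (fun s ↦ weilArchDensity (s / (1 + η)) * weilIncrement f s) 0 hc
  rw [mul_zero, smul_eq_mul] at h
  rw [← h]
  refine setIntegral_congr_fun measurableSet_Ioi fun t _ ↦ ?_
  simp only [weilIncrement_weilDilate f hη, mul_div_cancel_left₀ _ hc.ne']

/-- **Dominated convergence for the archimedean energy of dilates.** For `f ∈ L²` living on
`[-b, b]` (`b > 0`) with finite archimedean energy and `t ↦ D_t(f)` continuous: along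
`0 ≤ ηₙ ≤ 1`, `ηₙ → 0`, every `ρ D(f_{ηₙ})` is integrable on `(0, ∞)` and
`∫₀^∞ ρ D(f_{ηₙ}) → ∫₀^∞ ρ D(f)`. [folklore] -/
theorem tendsto_archEnergy_weilDilate {b : ℝ} (hb : 0 < b) {f : ℝ → ℂ} (hf : MemLp f 2)
    (hfs : ∀ x, x ∉ Icc (-b) b → f x = 0) (hD : Continuous (weilIncrement f))
    (hE : IntegrableOn (fun t ↦ weilArchDensity t * weilIncrement f t) (Ioi 0))
    {η : ℕ → ℝ} (hη0 : ∀ n, 0 ≤ η n) (hη1 : ∀ n, η n ≤ 1) (hη : Tendsto η atTop (𝓝 0)) :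
    (∀ n, IntegrableOn (fun t ↦ weilArchDensity t * weilIncrement (weilDilate (η n) f) t) (Ioi 0)) ∧
    Tendsto (fun n ↦ ∫ t in Ioi (0 : ℝ), weilArchDensity t * weilIncrement (weilDilate (η n) f) t)
      atTop (𝓝 (∫ t in Ioi (0 : ℝ), weilArchDensity t * weilIncrement f t)) := by
  set N : ℝ := ∫ x, ‖f x‖ ^ 2 with hN
  have hN0 : 0 ≤ N := integral_nonneg fun _ ↦ by positivity
  have hηm1 : ∀ n, -1 < η n := fun n ↦ by linarith [hη0 n]
  have hc : ∀ n, 0 < 1 + η n := fun n ↦ by linarith [hη0 n]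
  -- the substituted integrands and their dominator
  set F : ℕ → ℝ → ℝ := fun n s ↦ weilArchDensity (s / (1 + η n)) * weilIncrement f s with hF
  set q : ℝ := 1 - Real.exp (-(4 * b)) with hq
  have hq0 : 0 < q := by rw [hq, sub_pos, Real.exp_lt_one_iff]; linarith
  set bound : ℝ → ℝ := fun s ↦ 2 * Real.exp (b / 2) * (weilArchDensity s * weilIncrement f s) +
    2 * N * (2 * Real.exp (-(s / 4)) / q) with hbound
  have hDm : Measurable (weilIncrement f) := hD.measurable
  have hFm : ∀ n, AEStronglyMeasurable (F n) (volume.restrict (Ioi 0)) := fun n ↦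
    ((measurable_weilArchDensity.comp (measurable_id.div_const _)).mul hDm).aestronglyMeasurable
  -- pointwise bound on `(0, ∞)`
  have hFle : ∀ n, ∀ᵐ s ∂(volume.restrict (Ioi (0 : ℝ))), ‖F n s‖ ≤ bound s := by
    intro n
    refine (ae_restrict_iff' measurableSet_Ioi).2 (Eventually.of_forall fun s hs ↦ ?_)
    have hs0 : (0 : ℝ) < s := hs
    have hD0 : 0 ≤ weilIncrement f s := weilIncrement_nonneg f s
    have hρ0 : 0 < weilArchDensity s := weilArchDensity_pos hs0
    have hsc : 0 < s / (1 + η n) := div_pos hs0 (hc n)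
    -- `ρ(s/(1+η)) ≤ ρ(s/2) ≤ 2 e^{s/4} ρ(s)`
    have h1 : weilArchDensity (s / (1 + η n)) ≤ weilArchDensity (s / 2) :=
      weilArchDensity_antitoneOn (mem_Ioi.2 (by positivity)) (mem_Ioi.2 hsc)
        (div_le_div_of_nonneg_left hs0.le (hc n) (by linarith [hη1 n]))
    have h2 : weilArchDensity (s / 2) ≤ 2 * Real.exp (s / 4) * weilArchDensity s :=
      weilArchDensity_half_le hs0
    rw [Real.norm_of_nonneg (mul_nonneg (weilArchDensity_pos hsc).le hD0)]
    have hb1 : 0 ≤ 2 * Real.exp (b / 2) * (weilArchDensity s * weilIncrement f s) := by positivity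
    have hb2 : 0 ≤ 2 * N * (2 * Real.exp (-(s / 4)) / q) := by positivity
    rcases le_or_gt s (2 * b) with hsb | hsb
    · -- `s ≤ 2b`: `e^{s/4} ≤ e^{b/2}`
      have h3 : Real.exp (s / 4) ≤ Real.exp (b / 2) := Real.exp_le_exp.2 (by linarith)
      calc F n s ≤ weilArchDensity (s / 2) * weilIncrement f s :=
            mul_le_mul_of_nonneg_right h1 hD0
        _ ≤ 2 * Real.exp (s / 4) * weilArchDensity s * weilIncrement f s :=
            mul_le_mul_of_nonneg_right h2 hD0
        _ ≤ 2 * Real.exp (b / 2) * (weilArchDensity s * weilIncrement f s) := by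
            rw [mul_assoc]
            exact mul_le_mul_of_nonneg_right (mul_le_mul_of_nonneg_left h3 zero_le_two)
              (mul_nonneg hρ0.le hD0)
        _ ≤ bound s := le_add_of_nonneg_right hb2
    · -- `s > 2b`: `D_s(f) = 2N` and `ρ(s) ≤ e^{-s/2}/q`
      have h4 : weilIncrement f s = 2 * N := WeilParity.EvenWinsArch.dilationEnergy_weilIncrement_eq_two_mul hf hfs hsb.le
      have h5 : weilArchDensity s ≤ Real.exp (-(s / 2)) / q := weilArchDensity_le_exp_neg hb hsb.le
      have h6 : 2 * Real.exp (s / 4) * weilArchDensity s ≤ 2 * Real.exp (-(s / 4)) / q := by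
        calc 2 * Real.exp (s / 4) * weilArchDensity s ≤ 2 * Real.exp (s / 4) * (Real.exp (-(s / 2)) / q) :=
              mul_le_mul_of_nonneg_left h5 (by positivity)
          _ = 2 * Real.exp (-(s / 4)) / q := by
              rw [mul_div_assoc', mul_assoc, ← Real.exp_add]; ring_nf
      calc F n s ≤ weilArchDensity (s / 2) * weilIncrement f s :=
            mul_le_mul_of_nonneg_right h1 hD0
        _ ≤ (2 * Real.exp (-(s / 4)) / q) * (2 * N) := by
            rw [h4]; exact mul_le_mul_of_nonneg_right (h2.trans h6) (by positivity)
        _ = 2 * N * (2 * Real.exp (-(s / 4)) / q) := by ring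
        _ ≤ bound s := le_add_of_nonneg_left hb1
  -- the dominator is integrable on `(0, ∞)`
  have hbi : IntegrableOn bound (Ioi 0) := by
    refine Integrable.add (hE.const_mul _) ?_
    have he : IntegrableOn (fun s : ℝ ↦ Real.exp (-(s / 4))) (Ioi 0) := by
      have := exp_neg_integrableOn_Ioi 0 (by norm_num : (0 : ℝ) < 1 / 4)
      refine this.congr_fun (fun s _ ↦ ?_) measurableSet_Ioi
      ring_nf
    have h2 : IntegrableOn (fun s : ℝ ↦ 2 * N * (2 * Real.exp (-(s / 4)) / q)) (Ioi 0) :=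
      ((he.const_mul 2).div_const q).const_mul (2 * N)
    exact h2
  -- pointwise convergence `F n s → ρ(s) D_s(f)`
  have hFlim : ∀ᵐ s ∂(volume.restrict (Ioi (0 : ℝ))),
      Tendsto (fun n ↦ F n s) atTop (𝓝 (weilArchDensity s * weilIncrement f s)) := by
    refine (ae_restrict_iff' measurableSet_Ioi).2 (Eventually.of_forall fun s hs ↦ ?_)
    have hs0 : (0 : ℝ) < s := hs
    have h1 : Tendsto (fun n ↦ s / (1 + η n)) atTop (𝓝 (s / (1 + 0))) :=
      tendsto_const_nhds.div (tendsto_const_nhds.add hη) (by norm_num)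
    rw [add_zero, div_one] at h1
    exact ((continuousAt_weilArchDensity hs0).tendsto.comp h1).mul_const _
  have hDCT := tendsto_integral_of_dominated_convergence bound hFm hbi hFle hFlim
  -- integrability of each `F n` and of `ρ D(f_η)`
  have hFi : ∀ n, IntegrableOn (F n) (Ioi 0) := fun n ↦
    hbi.mono' (hFm n) (hFle n)
  have hint : ∀ n, IntegrableOn (fun t ↦ weilArchDensity t * weilIncrement (weilDilate (η n) f) t)
      (Ioi 0) := by
    intro n
    -- `t ↦ F n ((1+η) t)`: the substitution backwards
    have h0 : IntegrableOn (F n) (Ioi ((1 + η n) * 0)) := by rw [mul_zero]; exact hFi n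
    have h := (integrableOn_Ioi_comp_mul_left_iff (F n) 0 (hc n)).2 h0
    refine IntegrableOn.congr_fun h (fun t _ ↦ ?_) measurableSet_Ioi
    simp only [hF, weilIncrement_weilDilate f (hηm1 n), mul_div_cancel_left₀ _ (hc n).ne']
  refine ⟨hint, ?_⟩
  have e : ∀ n, ∫ t in Ioi (0 : ℝ), weilArchDensity t * weilIncrement (weilDilate (η n) f) t =
      (1 + η n)⁻¹ * ∫ s in Ioi (0 : ℝ), F n s := fun n ↦ archEnergy_weilDilate_eq f (hηm1 n)
  simp only [e]
  have h1 : Tendsto (fun n ↦ (1 + η n)⁻¹) atTop (𝓝 (1 + 0)⁻¹) :=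
    (tendsto_const_nhds.add hη).inv₀ (by norm_num)
  rw [add_zero, inv_one] at h1
  simpa using h1.mul hDCT

/-- **The energy of dilates converges**: under the hypotheses of `tendsto_archEnergy_weilDilate`
(and for `f` odd, to quote the continuity of increments), `𝓔_a(f_{ηₙ}) → 𝓔_a(f)`. [folklore] -/
theorem tendsto_weilDirichletEnergy_weilDilate (a : ℝ) {b : ℝ} (hb : 0 < b) {f : ℝ → ℂ}
    (hf : MemLp f 2) (hfs : ∀ x, x ∉ Icc (-b) b → f x = 0) (hfo : ∀ x, f (-x) = -f x)
    (hE : IntegrableOn (fun t ↦ weilArchDensity t * weilIncrement f t) (Ioi 0))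
    {η : ℕ → ℝ} (hη0 : ∀ n, 0 ≤ η n) (hη1 : ∀ n, η n ≤ 1) (hη : Tendsto η atTop (𝓝 0)) :
    Tendsto (fun n ↦ weilDirichletEnergy a (weilDilate (η n) f)) atTop
      (𝓝 (weilDirichletEnergy a f)) := by
  have hD : Continuous (weilIncrement f) := continuous_weilIncrement_of_memLp hf hfs hfo
  have hηm1 : ∀ n, -1 < η n := fun n ↦ by linarith [hη0 n]
  obtain ⟨-, harch⟩ := tendsto_archEnergy_weilDilate hb hf hfs hD hE hη0 hη1 hη
  have hprime : ∀ p : ℕ, Tendsto (fun n ↦ weilIncrement (weilDilate (η n) f) (Real.log p)) atTop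
      (𝓝 (weilIncrement f (Real.log p))) := by
    intro p
    simp only [weilIncrement_weilDilate f (hηm1 _)]
    have h1 : Tendsto (fun n ↦ (1 + η n) * Real.log p) atTop (𝓝 ((1 + 0) * Real.log p)) :=
      (tendsto_const_nhds.add hη).mul_const _
    rw [add_zero, one_mul] at h1
    exact (hD.tendsto _).comp h1
  unfold weilDirichletEnergy
  exact (tendsto_finsetSum _ fun p _ ↦ (hprime p).const_mul _).add harch

/-- **Registered form** (sub-goal `weilDirichletEnergy_weilDilate_tendsto` of item
stmt-RiemannHypothesis-17778): the energies of the dilates of an odd finite-energy window function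
converge as `η → 0⁺`. [folklore] -/
theorem weilDirichletEnergy_weilDilate_tendsto :
    ∀ (a b : ℝ) (f : ℝ → ℂ) (η : ℕ → ℝ), 0 < b → MemLp f 2 → (∀ x, x ∉ Icc (-b) b → f x = 0) →
      (∀ x, f (-x) = -f x) → IntegrableOn (fun t ↦ weilArchDensity t * weilIncrement f t) (Ioi 0) →
      (∀ n, 0 ≤ η n) → (∀ n, η n ≤ 1) → Tendsto η atTop (𝓝 0) →
      Tendsto (fun n ↦ weilDirichletEnergy a (weilDilate (η n) f)) atTop
        (𝓝 (weilDirichletEnergy a f)) :=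
  fun a _ _ _ hb hf hfs hfo hE hη0 hη1 hη ↦
    tendsto_weilDirichletEnergy_weilDilate a hb hf hfs hfo hE hη0 hη1 hη

end Summit.RiemannHypothesis.RiemannHypothesis.Theorems.OddSector

end
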